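import Summits.BirchSwinnertonDyer.Rank1Residual.Additive.SemistabilityDefectRamification
import Mathlib.NumberTheory.NumberField.Cyclotomic.Galois
import Mathlib.FieldTheory.KrullTopology
import HarnessLib

/-!
# X3♯/X4♯ (G-ord): subfields of `ℚ(ζ_p)` — total ramification at `p`, one subfield per degree `d ∣ p − 1`, and every (G)-field has degree divisible by `e_E(p)`

HONEST FRAMING (cell `b2b-bsdres`, run/shared/lean/b2b/bsd-rank1-residual/, verbatim in every
file): the goal of the cell is to DELETE the COMBINATION-SHAPED residual classes of the
Birch–Swinnerton-Dyer formula for ALL analytic-rank `≤ 1` elliptic curves over `ℚ` — "full BSD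
formula for every rank `≤ 1` curve in class `C`" assembled STRICTLY from published theorems — so
that the rank-`≤ 1` remainder becomes exactly the CONSTRUCTION-SHAPED classes, which are TYPED
(missing-input `Prop`s), NOT attempted. This is not "finishing BSD". Sub-cell `additive-p2`
(CLASS-OWNERS row "X3/X4 additive — pot. good ordinary / X3♯(G-ord)"), generation 5: research
route; no claim beyond the stated classes; theorems only, no definition, no new named fact;
X3♯(G-ord)/X4♯(G-ord) stay CONSTRUCTION-SHAPED.

WHAT THIS FILE DOES. The field-theoretic bookkeeping behind Delbourgo's hypothesis (G)
(Compositio Math. 113 (1998) §1.5: "`E` possesses good reduction over a field `L ⊂ ℚ_p(μ_p)`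
where `[L : ℚ_p] = d`", `d = #Φ_p` the order of the inertia group, §1.3) and behind the module
docstring of `PotGoodOrdinary.lean` ("equivalent to the local statement because `ℚ(ζ_p)/ℚ` is
cyclic, totally ramified at `p`"), now in the kernel:

* `ramificationIdx_eq_finrank_of_intermediateField_cyclotomic` — for EVERY subfield `F` of a
  `p`-th cyclotomic field and every prime `w ∣ p` of `F`: **`e(w|p) = [F : ℚ]`** (tower formula +
  total ramification `e(𝔓|p) = p − 1 = [ℚ(ζ_p) : ℚ]` + the two bounds `e ≤ degree` of the
  fundamental identity); `inertiaDeg_eq_one_of_intermediateField_cyclotomic` (`f(w|p) = 1`);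
  `heightOneSpectrum_eq_of_intermediateField_cyclotomic` (the prime above `p` is UNIQUE). Gen 2's
  `ramificationIdx_dvd_sub_one_of_intermediateField_cyclotomic` (`e(w|p) ∣ p − 1`) and gen 3's
  `absNorm_eq_of_intermediateField_cyclotomic` (`N(w) = p`) are the weak forms used so far.
* `exists_intermediateField_finrank_eq_of_dvd`, `intermediateField_eq_of_finrank_eq`,
  `existsUnique_intermediateField_finrank_eq_of_dvd`, `finrank_intermediateField_dvd_sub_one` —
  **for every `d ∣ p − 1` there is exactly one subfield of `ℚ(ζ_p)` of degree `d`** (Galois over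
  `ℚ`), and every subfield has degree dividing `p − 1` (cyclic Galois group `≅ (ℤ/p)ˣ`, Mathlib
  `IsCyclotomicExtension.Rat.galEquivZMod`; a subgroup of a finite cyclic group is determined by
  its index; adapted from the tree's `Honda1971.exists_intermediateField_finrank_eq_three`).
* `semistabilityIndex_dvd_finrank_of_forall_hasGoodReductionAt`,
  `semistabilityIndex_le_finrank_of_forall_hasGoodReductionAt` — **every subfield `F ⊆ ℚ(ζ_p)`
  over which `E` is good above `p` has `e_E(p) ∣ [F : ℚ]`** (any `p`; gen 4's
  `semistabilityIndex_dvd_ramificationIdx_of_hasGoodReductionAt` with `e(w|p) = [F : ℚ]`); so a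
  (G)-field has degree `≥ e_E(p)`. The converse and the minimal (G)-field (Delbourgo's `d` IS
  `e_E(p)`) are in the sibling file `MinimalGoodReductionField.lean` (needs gen 4's
  `SemistableFieldCriterion.lean`).

Located gap / labels / census UNCHANGED (HOME/b2b-bsdres-additive-p2/AUDIT-X34-GORD.md): this is
bookkeeping that makes the sub-cell's transcription of (G) and of Delbourgo's `d` exact; it moves
no pair.

References: L. C. Washington, *Introduction to Cyclotomic Fields* (2nd ed., 1997), Lemma 1.4,
Prop. 2.3, Thm. 2.5 and Ch. 2; J. Neukirch, *Algebraic Number Theory*, Ch. I (8.2) (fundamental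
identity); D. Delbourgo, Compositio Math. 113 (1998) §1.3 (the group `Φ_p`, Lemma (i)⟺(iv)),
§1.5 (G); J.-P. Serre, Invent. Math. 15 (1972) §5.6 (`Φ_p` cyclic of order
`12/gcd(12, v_p(Δ))` for `p ≥ 5`); J.-P. Serre, J. Tate, Ann. of Math. 88 (1968) §2.
-/

noncomputable section

open scoped Classical NumberField

open WeierstrassCurve IsDedekindDomain NumberField Literature.NumberTheory.EllipticCurves
  Literature.NumberTheory.EllipticCurves.Rank1Residual

namespace Summit.BirchSwinnertonDyer.Rank1Residual.Additive

/-! ### Subfields of a `p`-th cyclotomic field: `e(w|p) = [F : ℚ]`, `f(w|p) = 1`, `w` unique -/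

section Cyclotomic

variable {L : Type} [Field L] [NumberField L] (p : ℕ) [hp : Fact p.Prime]
  [hcyc : IsCyclotomicExtension {p} ℚ L] (F : IntermediateField ℚ L)

/-- The ideal `(p) ⊆ ℤ` is maximal and nonzero (bookkeeping). -/
private theorem span_natCast_isMaximal : (Ideal.span {(p : ℤ)}).IsMaximal :=
  Ideal.IsPrime.isMaximal
    ((Ideal.span_singleton_prime (by exact_mod_cast hp.out.ne_zero)).mpr
      (Nat.prime_iff_prime_int.mp hp.out))
    (by rw [Ne, Ideal.span_singleton_eq_bot]; exact_mod_cast hp.out.ne_zero)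

/-- **Every subfield `F` of a `p`-th cyclotomic field is totally ramified at `p`:
`e(w|p) = [F : ℚ]`** for every prime `w ∣ p` of `F`. Choose `𝔓 ∣ w` in `L = ℚ(ζ_p)`; then
`e(𝔓|p) = e(w|p)·e(𝔓|w)` (Mathlib `Ideal.ramificationIdx'_algebra_tower`), `e(𝔓|p) = p − 1 =
[L : ℚ] = [F : ℚ]·[L : F]` (total ramification of `p` in `ℚ(ζ_p)`, Mathlib
`IsCyclotomicExtension.Rat.ramificationIdx_eq_of_prime_pow`, `IsCyclotomicExtension.finrank`),
while `e(w|p) ≤ [F : ℚ]` and `e(𝔓|w) ≤ [L : F]` (fundamental identity, Mathlib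
`Ideal.ramificationIdx_le_finrank`); so both inequalities are equalities.
Washington, *Introduction to Cyclotomic Fields*, Lemma 1.4 / Prop. 2.3. -/
theorem ramificationIdx_eq_finrank_of_intermediateField_cyclotomic
    (w : HeightOneSpectrum (𝓞 F)) [hw : w.asIdeal.LiesOver (Ideal.span {(p : ℤ)})] :
    (Ideal.span {(p : ℤ)}).ramificationIdx' w.asIdeal = Module.finrank ℚ F := by
  haveI : NumberField F := NumberField.of_module_finite ℚ F
  haveI hcyc' : IsCyclotomicExtension {p ^ (0 + 1)} ℚ L := by
    rw [zero_add, pow_one]; exact hcyc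
  haveI := w.isMaximal
  haveI := span_natCast_isMaximal p
  obtain ⟨Q, hQmax, hQover⟩ :=
    Ideal.exists_maximal_ideal_liesOver_of_isIntegral (S := 𝓞 L) w.asIdeal
  haveI := hQover
  haveI : Q.IsPrime := hQmax.isPrime
  haveI : Q.LiesOver (Ideal.span {(p : ℤ)}) := Ideal.LiesOver.trans Q w.asIdeal _
  have hpbot : Ideal.span {(p : ℤ)} ≠ ⊥ := by
    rw [Ne, Ideal.span_singleton_eq_bot]; exact_mod_cast hp.out.ne_zero
  -- `e(𝔓|p) = p − 1 = [L : ℚ]`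
  have heL : (Ideal.span {(p : ℤ)}).ramificationIdx' Q = p - 1 := by
    rw [Ideal.ramificationIdx'_eq_ramificationIdx _ _ hpbot,
      IsCyclotomicExtension.Rat.ramificationIdx_eq_of_prime_pow p 0 L Q, pow_zero, one_mul]
  have hL : Module.finrank ℚ L = p - 1 := by
    rw [IsCyclotomicExtension.finrank L (Polynomial.cyclotomic.irreducible_rat hp.out.pos),
      Nat.totient_prime hp.out]
  -- tower `e(𝔓|p) = e(w|p)·e(𝔓|w)`
  have hg0 : Ideal.map (algebraMap (𝓞 F) (𝓞 L)) w.asIdeal ≠ ⊥ := by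
    rw [Ne, Ideal.map_eq_bot_iff_of_injective (RingOfIntegers.algebraMap.injective F L)]
    exact w.ne_bot
  have hfg : Ideal.map (algebraMap ℤ (𝓞 L)) (Ideal.span {(p : ℤ)}) ≠ ⊥ :=
    Ideal.map_ne_bot_of_ne_bot hpbot
  have hg : Ideal.map (algebraMap (𝓞 F) (𝓞 L)) w.asIdeal ≤ Q :=
    Ideal.map_le_iff_le_comap.mpr (le_of_eq hQover.over)
  have htower := Ideal.ramificationIdx'_algebra_tower (p := Ideal.span {(p : ℤ)}) hg0 hfg hg
  -- the two bounds from the fundamental identity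
  haveI : NoZeroSMulDivisors (𝓞 F) (𝓞 L) := ⟨fun {a x} h => by
    rw [Algebra.smul_def, mul_eq_zero] at h
    rcases h with h | h
    · exact Or.inl (RingOfIntegers.algebraMap.injective F L (by rw [h, map_zero]))
    · exact Or.inr h⟩
  have h1 : (Ideal.span {(p : ℤ)}).ramificationIdx' w.asIdeal ≤ Module.finrank ℚ F :=
    Ideal.ramificationIdx_le_finrank (𝓞 F) ℚ F w.asIdeal (p := Ideal.span {(p : ℤ)})
  have h2 : w.asIdeal.ramificationIdx' Q ≤ Module.finrank F L :=
    Ideal.ramificationIdx_le_finrank (𝓞 L) F L Q (p := w.asIdeal)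
  have hFL : Module.finrank ℚ F * Module.finrank F L = Module.finrank ℚ L :=
    Module.finrank_mul_finrank ℚ F L
  -- squeeze
  have hprod : (Ideal.span {(p : ℤ)}).ramificationIdx' w.asIdeal * w.asIdeal.ramificationIdx' Q =
      Module.finrank ℚ F * Module.finrank F L := by rw [← htower, heL, hFL, hL]
  have hpos2 : 0 < w.asIdeal.ramificationIdx' Q :=
    Nat.pos_of_ne_zero (Ideal.IsDedekindDomain.ramificationIdx'_ne_zero_of_liesOver Q w.ne_bot)
  by_contra hne
  have hlt : (Ideal.span {(p : ℤ)}).ramificationIdx' w.asIdeal < Module.finrank ℚ F :=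
    lt_of_le_of_ne h1 hne
  have : (Ideal.span {(p : ℤ)}).ramificationIdx' w.asIdeal * w.asIdeal.ramificationIdx' Q <
      Module.finrank ℚ F * Module.finrank F L :=
    calc (Ideal.span {(p : ℤ)}).ramificationIdx' w.asIdeal * w.asIdeal.ramificationIdx' Q
        < Module.finrank ℚ F * w.asIdeal.ramificationIdx' Q := Nat.mul_lt_mul_of_pos_right hlt hpos2
      _ ≤ Module.finrank ℚ F * Module.finrank F L := Nat.mul_le_mul_left _ h2
  omega

/-- **The residue degree of `w ∣ p` in a subfield of `ℚ(ζ_p)` is `1`**: the summand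
`e(w|p)·f(w|p)` of the fundamental identity `Σ e f = [F : ℚ]` (Mathlib
`Ideal.sum_ramification_inertia`) already has `e(w|p) = [F : ℚ]`. -/
theorem inertiaDeg_eq_one_of_intermediateField_cyclotomic
    (w : HeightOneSpectrum (𝓞 F)) [hw : w.asIdeal.LiesOver (Ideal.span {(p : ℤ)})] :
    (Ideal.span {(p : ℤ)}).inertiaDeg' w.asIdeal = 1 := by
  classical
  haveI : NumberField F := NumberField.of_module_finite ℚ F
  haveI := span_natCast_isMaximal p
  have hpbot : Ideal.span {(p : ℤ)} ≠ ⊥ := by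
    rw [Ne, Ideal.span_singleton_eq_bot]; exact_mod_cast hp.out.ne_zero
  have he := ramificationIdx_eq_finrank_of_intermediateField_cyclotomic p F w
  have hsum := Ideal.sum_ramification_inertia (R := ℤ) (S := 𝓞 F) ℚ F hpbot
  have hwmem : w.asIdeal ∈ IsDedekindDomain.primesOverFinset (Ideal.span {(p : ℤ)}) (𝓞 F) :=
    (IsDedekindDomain.mem_primesOverFinset_iff hpbot _).mpr ⟨w.isPrime, hw⟩
  have hle := Finset.single_le_sum (f := fun P : Ideal (𝓞 F) =>
      (Ideal.span {(p : ℤ)}).ramificationIdx' P * (Ideal.span {(p : ℤ)}).inertiaDeg' P)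
    (fun _ _ => Nat.zero_le _) hwmem
  simp only [hsum] at hle
  rw [he] at hle
  have hf0 : (Ideal.span {(p : ℤ)}).inertiaDeg' w.asIdeal ≠ 0 := Ideal.inertiaDeg'_ne_zero _ _
  have hFpos : 0 < Module.finrank ℚ F := Module.finrank_pos
  have hf1 : (Ideal.span {(p : ℤ)}).inertiaDeg' w.asIdeal ≤ 1 := by
    by_contra h
    have h2 : 2 ≤ (Ideal.span {(p : ℤ)}).inertiaDeg' w.asIdeal := by omega
    nlinarith
  omega

/-- **There is exactly one prime of a subfield of `ℚ(ζ_p)` above `p`**: two distinct primes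
`v, w ∣ p` would contribute `e(v|p) f(v|p) + e(w|p) f(w|p) ≥ [F : ℚ] + 1` to the fundamental
identity `Σ e f = [F : ℚ]`. -/
theorem heightOneSpectrum_eq_of_intermediateField_cyclotomic
    (v w : HeightOneSpectrum (𝓞 F)) [hv : v.asIdeal.LiesOver (Ideal.span {(p : ℤ)})]
    [hw : w.asIdeal.LiesOver (Ideal.span {(p : ℤ)})] : v = w := by
  -- adapted from Literature/NumberTheory/NumberFields/PureCubicClassNumberModThreeProofs.lean
  -- (`Honda1971.eq_of_mem_of_mem`)
  classical
  by_contra hne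
  haveI : NumberField F := NumberField.of_module_finite ℚ F
  haveI := span_natCast_isMaximal p
  have hpbot : Ideal.span {(p : ℤ)} ≠ ⊥ := by
    rw [Ne, Ideal.span_singleton_eq_bot]; exact_mod_cast hp.out.ne_zero
  set P : Ideal ℤ := Ideal.span {(p : ℤ)} with hPdef
  have hev := ramificationIdx_eq_finrank_of_intermediateField_cyclotomic p F v
  have hew := ramificationIdx_eq_finrank_of_intermediateField_cyclotomic p F w
  have hsum := Ideal.sum_ramification_inertia (R := ℤ) (S := 𝓞 F) ℚ F hpbot
  have hvmem : v.asIdeal ∈ IsDedekindDomain.primesOverFinset P (𝓞 F) :=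
    (IsDedekindDomain.mem_primesOverFinset_iff hpbot _).mpr ⟨v.isPrime, hv⟩
  have hwmem : w.asIdeal ∈ IsDedekindDomain.primesOverFinset P (𝓞 F) :=
    (IsDedekindDomain.mem_primesOverFinset_iff hpbot _).mpr ⟨w.isPrime, hw⟩
  have hne' : v.asIdeal ≠ w.asIdeal := fun h => hne (HeightOneSpectrum.ext h)
  have h2 : P.ramificationIdx' v.asIdeal * P.inertiaDeg' v.asIdeal +
      P.ramificationIdx' w.asIdeal * P.inertiaDeg' w.asIdeal ≤ Module.finrank ℚ F := by
    rw [← hsum]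
    calc P.ramificationIdx' v.asIdeal * P.inertiaDeg' v.asIdeal +
          P.ramificationIdx' w.asIdeal * P.inertiaDeg' w.asIdeal
        = ∑ x ∈ ({v.asIdeal, w.asIdeal} : Finset (Ideal (𝓞 F))),
            P.ramificationIdx' x * P.inertiaDeg' x :=
          (Finset.sum_pair (f := fun x => P.ramificationIdx' x * P.inertiaDeg' x) hne').symm
      _ ≤ _ := Finset.sum_le_sum_of_subset
            (Finset.insert_subset_iff.mpr ⟨hvmem, Finset.singleton_subset_iff.mpr hwmem⟩)
  rw [hev, hew] at h2
  have hfv : 0 < P.inertiaDeg' v.asIdeal := Nat.pos_of_ne_zero (Ideal.inertiaDeg'_ne_zero P _)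
  have hfw : 0 < P.inertiaDeg' w.asIdeal := Nat.pos_of_ne_zero (Ideal.inertiaDeg'_ne_zero P _)
  have hFpos : 0 < Module.finrank ℚ F := Module.finrank_pos
  nlinarith

/-! ### Subfields of `ℚ(ζ_p)` of prescribed degree: one for each `d ∣ p − 1` -/

/-- In a finite cyclic commutative group a subgroup is the group of `d`-th powers, `d` its
index; so two subgroups with the same index coincide. (Private copy, adapted from
`Subgroup.eq_of_index_eq_of_isCyclic` in
`Literature/NumberTheory/NumberFields/AbelianPExtensionCyclic.lean`, to keep this file's import
closure inside the sub-cell.) -/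
private theorem subgroup_eq_of_index_eq {Γ : Type*} [CommGroup Γ] [IsCyclic Γ] [Finite Γ]
    {A B : Subgroup Γ} (h : A.index = B.index) : A = B := by
  have key : ∀ C : Subgroup Γ, C = (powMonoidHom C.index : Γ →* Γ).range := by
    intro C
    symm
    refine Subgroup.eq_of_le_of_card_ge ?_ ?_
    · rintro _ ⟨g, rfl⟩
      exact C.pow_index_mem g
    · rw [IsCyclic.card_powMonoidHom_range, Nat.gcd_eq_right C.index_dvd_card]
      exact (Nat.div_eq_of_eq_mul_left (Nat.pos_of_ne_zero C.index_ne_zero_of_finite)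
        C.card_mul_index.symm).ge
  rw [key A, key B, h]

/-- **For every `d ∣ p − 1` a `p`-th cyclotomic field has a subfield of degree `d`**, Galois over
`ℚ`: the fixed field of the `d`-th powers in the cyclic group `Gal(ℚ(ζ_p)/ℚ) ≅ (ℤ/p)ˣ` of order
`p − 1` (Mathlib `IsCyclotomicExtension.Rat.galEquivZMod`, `IsCyclic.index_powMonoidHom_range`).
Adapted from the tree's `Honda1971.exists_intermediateField_finrank_eq_three` (the case `d = 3`).
Washington, *Introduction to Cyclotomic Fields*, Ch. 2. -/
theorem exists_intermediateField_finrank_eq_of_dvd (L : Type) [Field L] [NumberField L]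
    [IsCyclotomicExtension {p} ℚ L] {d : ℕ} (hd : d ∣ p - 1) :
    ∃ C : IntermediateField ℚ L, IsGalois ℚ C ∧ Module.finrank ℚ C = d := by
  classical
  haveI : IsGalois ℚ L := IsCyclotomicExtension.isGalois {p} ℚ L
  let e : Gal(L/ℚ) ≃* (ZMod p)ˣ := IsCyclotomicExtension.Rat.galEquivZMod p L
  have hcomm : ∀ a b : Gal(L/ℚ), a * b = b * a := fun a b =>
    e.injective (by rw [map_mul, map_mul, mul_comm])
  let H : Subgroup Gal(L/ℚ) :=
    ((powMonoidHom d : (ZMod p)ˣ →* (ZMod p)ˣ).range).comap e.toMonoidHom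
  haveI hHn : H.Normal := ⟨fun n hn g => by rwa [hcomm g n, mul_inv_cancel_right]⟩
  have hidx : H.index = d := by
    have hsurj : Function.Surjective e.toMonoidHom := e.surjective
    dsimp only [H]
    rw [Subgroup.index_comap_of_surjective _ hsurj, IsCyclic.index_powMonoidHom_range,
      Nat.card_eq_fintype_card, ZMod.card_units p]
    exact Nat.gcd_eq_right hd
  refine ⟨IntermediateField.fixedField H, IsGalois.of_fixedField_normal_subgroup H, ?_⟩
  have htower := Module.finrank_mul_finrank ℚ (IntermediateField.fixedField H) L
  rw [IntermediateField.finrank_fixedField_eq_card, ← IsGalois.card_aut_eq_finrank ℚ L,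
    ← Subgroup.card_mul_index H, hidx] at htower
  have hH0 : Nat.card H ≠ 0 := Nat.card_pos.ne'
  rw [mul_comm] at htower
  exact Nat.eq_of_mul_eq_mul_left (Nat.pos_of_ne_zero hH0) htower

include hcyc in
/-- **A subfield of `ℚ(ζ_p)` is determined by its degree** (the Galois group is cyclic, and a
subgroup of a finite cyclic group is determined by its index; Mathlib
`IntermediateField.finrank_eq_fixingSubgroup_index`, `IsGalois.fixedField_fixingSubgroup`).
Washington, *Introduction to Cyclotomic Fields*, Ch. 2. -/
theorem intermediateField_eq_of_finrank_eq (F C : IntermediateField ℚ L)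
    (h : Module.finrank ℚ F = Module.finrank ℚ C) : F = C := by
  classical
  haveI : IsGalois ℚ L := IsCyclotomicExtension.isGalois {p} ℚ L
  let e : Gal(L/ℚ) ≃* (ZMod p)ˣ := IsCyclotomicExtension.Rat.galEquivZMod p L
  have hidx : (F.fixingSubgroup.map (e : Gal(L/ℚ) →* (ZMod p)ˣ)).index =
      (C.fixingSubgroup.map (e : Gal(L/ℚ) →* (ZMod p)ˣ)).index := by
    rw [Subgroup.index_map_equiv, Subgroup.index_map_equiv,
      ← IntermediateField.finrank_eq_fixingSubgroup_index,
      ← IntermediateField.finrank_eq_fixingSubgroup_index, h]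
  have hmap := subgroup_eq_of_index_eq hidx
  have hinj : Function.Injective ((e : Gal(L/ℚ) →* (ZMod p)ˣ)) := fun a b hab => e.injective hab
  have hsub : F.fixingSubgroup = C.fixingSubgroup := by
    rw [← Subgroup.comap_map_eq_self_of_injective hinj F.fixingSubgroup,
      ← Subgroup.comap_map_eq_self_of_injective hinj C.fixingSubgroup, hmap]
  rw [← IsGalois.fixedField_fixingSubgroup F, ← IsGalois.fixedField_fixingSubgroup C, hsub]

/-- Hence **for every `d ∣ p − 1` there is EXACTLY ONE subfield of `ℚ(ζ_p)` of degree `d`**. -/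
theorem existsUnique_intermediateField_finrank_eq_of_dvd (L : Type) [Field L] [NumberField L]
    [IsCyclotomicExtension {p} ℚ L] {d : ℕ} (hd : d ∣ p - 1) :
    ∃! C : IntermediateField ℚ L, Module.finrank ℚ C = d := by
  obtain ⟨C, -, hC⟩ := exists_intermediateField_finrank_eq_of_dvd p L hd
  exact ⟨C, hC, fun C' hC' => intermediateField_eq_of_finrank_eq p C' C (hC'.trans hC.symm)⟩

/-- Conversely the degree of any subfield of `ℚ(ζ_p)` divides `p − 1 = [ℚ(ζ_p) : ℚ]`. -/
theorem finrank_intermediateField_dvd_sub_one : Module.finrank ℚ F ∣ p - 1 := by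
  have hL : Module.finrank ℚ L = p - 1 := by
    rw [IsCyclotomicExtension.finrank L (Polynomial.cyclotomic.irreducible_rat hp.out.pos),
      Nat.totient_prime hp.out]
  rw [← hL]
  exact Dvd.intro _ (Module.finrank_mul_finrank ℚ F L)

end Cyclotomic

/-! ### Every (G)-field inside `ℚ(ζ_p)` has degree divisible by the semistability defect -/

section Curve

variable (W : WeierstrassCurve ℚ) [W.IsElliptic] [W.IsGloballyMinimal] (p : ℕ) [hp : Fact p.Prime]
  {L : Type} [Field L] [NumberField L] [hcyc : IsCyclotomicExtension {p} ℚ L]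
  (F : IntermediateField ℚ L)

include hcyc in
/-- **Every (G)-field inside `ℚ(ζ_p)` has degree divisible by `e_E(p)`** (any prime `p`, no
hypothesis on `j`: gen 4's `semistabilityIndex_dvd_ramificationIdx_of_hasGoodReductionAt` is
valid at every `p`). -/
theorem semistabilityIndex_dvd_finrank_of_forall_hasGoodReductionAt
    (hF : ∀ w : HeightOneSpectrum (𝓞 F), (p : 𝓞 F) ∈ w.asIdeal →
      (W.baseChange F).HasGoodReductionAt w) :
    semistabilityIndex W p ∣ Module.finrank ℚ F := by
  haveI : NumberField F := NumberField.of_module_finite ℚ F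
  obtain ⟨w, hw⟩ := exists_heightOneSpectrum_natCast_mem F p
  haveI := liesOver_span_of_natCast_mem p F w hw
  rw [← ramificationIdx_eq_finrank_of_intermediateField_cyclotomic p F w]
  exact semistabilityIndex_dvd_ramificationIdx_of_hasGoodReductionAt W p F w hw (hF w hw)

include hcyc in
/-- In particular a (G)-field inside `ℚ(ζ_p)` has degree `≥ e_E(p)`. -/
theorem semistabilityIndex_le_finrank_of_forall_hasGoodReductionAt
    (hF : ∀ w : HeightOneSpectrum (𝓞 F), (p : 𝓞 F) ∈ w.asIdeal →
      (W.baseChange F).HasGoodReductionAt w) :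
    semistabilityIndex W p ≤ Module.finrank ℚ F := by
  haveI : NumberField F := NumberField.of_module_finite ℚ F
  exact Nat.le_of_dvd Module.finrank_pos
    (semistabilityIndex_dvd_finrank_of_forall_hasGoodReductionAt W p F hF)

end Curve

end Summit.BirchSwinnertonDyer.Rank1Residual.Additive

end
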